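import Mathlib.Tactic
import HarnessLib

/-!
# ω-census family (a): the finite lemma of the slack-3 argument over `𝔽₇` — rectangle parity forces `Σ μ(3−μ) ≥ 48`

Cell `pub-omega` (unit `pub-omega-tensor-g13`), topic `Summits/MatrixMultiplication/OmegaCensus` (sub-folder `SmallFormats`).
Framing (verbatim): lottery ticket; floor = certified bounds/negative ranges. HONEST FRAMING: an elementary combinatorial lemma about
`8 × 8` matrices of naturals (no group theory, no data); it is step (3b) of `pub-omega-tensor-g13/METHOD-MOMENT-g13.md` and is used by
the kernel proof of `NoTightPoint7 3 156`. Nothing here is progress on `ω`.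

STATEMENT (`parity_bound7`). Let `μ : ℕ → ℕ → ℕ` have entries `≤ 3` and all row and column sums `6` on `8 × 8`, and satisfy
RECTANGLE PARITY: `μ w x + μ w 0 + μ 0 x + μ 0 0` is even for all `w, x < 8` (equivalently `μ ≡ α_x + β_w (mod 2)`). Then
`Σ_{w,x} μ(w,x)·(3 − μ(w,x)) ≥ 48`, i.e. at least `24` entries lie in `{1, 2}` (equivalently `Σ μ² ≤ 96`).
PROOF. With `odd(w,x) = (β_w + α_x) mod 2` and `t` = number of entries `3`: pointwise `μ(3−μ) + 4[μ=3] = μ + [odd]`, so the claim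
is `4t ≤ #odd`; a row with `k` odd cells carries at most `(6−k)/2` threes (odd cells are `≥ 1`, threes are odd), likewise columns;
the odd cells form the two blocks `{β=0}×{α=1}` and `{β=1}×{α=0}`, whence `2t ≤ min((8−B)(6−A), A(B−2)) + min(B(A−2), (8−A)(6−B))`
with `A = |α|`, `B = |β|`, and the arithmetic `… ≤ (8−B)A + B(8−A) = #odd` is checked for all `A, B ≤ 8` (`arith_core7`).
-/

namespace Summit.MatrixMultiplication.OmegaCensus.SmallFormats

open Finset

/-- The arithmetic core: for all block sizes `A, B ≤ 8` compatible with rows/columns of at most `6` odd cells, twice the two block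
bounds on the number of threes never exceed the number of odd cells. (`81` cases, by `decide`.) -/
theorem arith_core7 : ∀ a b : Fin 9,
    ((b.val < 8 → a.val ≤ 6) ∧ (0 < b.val → 2 ≤ a.val) ∧ (a.val < 8 → b.val ≤ 6) ∧ (0 < a.val → 2 ≤ b.val)) →
    2 * min ((8 - b.val) * (6 - a.val)) (a.val * (b.val - 2)) + 2 * min (b.val * (a.val - 2)) ((8 - a.val) * (6 - b.val))
      ≤ (8 - b.val) * a.val + b.val * (8 - a.val) := by
  decide

/-- A sum of `0/1`-values over `range 8` is at most `8`. -/
theorem sum_range8_le_of_le_one {f : ℕ → ℕ} (hf : ∀ i < 8, f i ≤ 1) : ∑ i ∈ range 8, f i ≤ 8 := by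
  calc ∑ i ∈ range 8, f i ≤ ∑ i ∈ range 8, 1 := sum_le_sum fun i hi => hf i (mem_range.1 hi)
    _ = 8 := by simp

/-- **The finite lemma** (see the module docstring). -/
theorem parity_bound7 (μ : ℕ → ℕ → ℕ) (h3 : ∀ w x, w < 8 → x < 8 → μ w x ≤ 3)
    (hrow : ∀ w < 8, ∑ x ∈ range 8, μ w x = 6) (hcol : ∀ x < 8, ∑ w ∈ range 8, μ w x = 6)
    (hrect : ∀ w x, w < 8 → x < 8 → (μ w x + μ w 0 + μ 0 x + μ 0 0) % 2 = 0) :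
    48 ≤ ∑ w ∈ range 8, ∑ x ∈ range 8, μ w x * (3 - μ w x) := by
  -- parity pattern
  set β : ℕ → ℕ := fun w => μ w 0 % 2 with hβ
  set α : ℕ → ℕ := fun x => (μ 0 x + μ 0 0) % 2 with hα
  have hβle : ∀ w, β w ≤ 1 := fun w => by simp only [hβ]; omega
  have hαle : ∀ x, α x ≤ 1 := fun x => by simp only [hα]; omega
  set od : ℕ → ℕ → ℕ := fun w x => (β w + α x) % 2 with hod
  set th : ℕ → ℕ → ℕ := fun w x => if μ w x = 3 then 1 else 0 with hth
  have hpar : ∀ w x, w < 8 → x < 8 → μ w x % 2 = od w x := by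
    intro w x hw hx
    have := hrect w x hw hx
    simp only [hod, hβ, hα]
    omega
  -- pointwise facts
  have P1 : ∀ w x, w < 8 → x < 8 → μ w x * (3 - μ w x) + 4 * th w x = μ w x + od w x := by
    intro w x hw hx
    have hp := hpar w x hw hx
    have hle := h3 w x hw hx
    simp only [hth]
    interval_cases hμ : μ w x <;> norm_num at hp ⊢ <;> omega
  have P2 : ∀ w x, w < 8 → x < 8 → od w x + 2 * th w x ≤ μ w x := by
    intro w x hw hx
    have hp := hpar w x hw hx
    have hle := h3 w x hw hx
    simp only [hth]
    interval_cases hμ : μ w x <;> norm_num at hp ⊢ <;> omega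
  have P3 : ∀ w x, w < 8 → x < 8 → th w x = 1 → od w x = 1 := by
    intro w x hw hx h1
    have hp := hpar w x hw hx
    by_cases h33 : μ w x = 3
    · rw [← hp, h33]
    · simp only [hth, if_neg h33] at h1
      exact absurd h1 (by norm_num)
  have thle : ∀ w x, th w x ≤ 1 := fun w x => by simp only [hth]; split_ifs <;> omega
  -- global sums
  set S := ∑ w ∈ range 8, ∑ x ∈ range 8, μ w x * (3 - μ w x) with hS
  set T := ∑ w ∈ range 8, ∑ x ∈ range 8, th w x with hT
  set O := ∑ w ∈ range 8, ∑ x ∈ range 8, od w x with hO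
  have hsum48 : ∑ w ∈ range 8, ∑ x ∈ range 8, μ w x = 48 := by
    rw [sum_congr rfl fun w hw => hrow w (mem_range.1 hw)]; simp
  have E1 : S + 4 * T = 48 + O := by
    rw [hS, hT, hO, ← hsum48, mul_sum, ← sum_add_distrib, ← sum_add_distrib]
    refine sum_congr rfl fun w hw => ?_
    rw [mul_sum, ← sum_add_distrib, ← sum_add_distrib]
    exact sum_congr rfl fun x hx => P1 w x (mem_range.1 hw) (mem_range.1 hx)
  -- A, B and the number of odd cells
  set A := ∑ x ∈ range 8, α x with hA
  set B := ∑ w ∈ range 8, β w with hB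
  have hA8 : A ≤ 8 := sum_range8_le_of_le_one fun x _ => hαle x
  have hB8 : B ≤ 8 := sum_range8_le_of_le_one fun w _ => hβle w
  have krow : ∀ w, ∑ x ∈ range 8, od w x = if β w = 0 then A else 8 - A := by
    intro w
    by_cases hb : β w = 0
    · rw [if_pos hb]
      refine sum_congr rfl fun x _ => ?_
      simp only [hod, hb, zero_add]
      have := hαle x; omega
    · rw [if_neg hb]
      have hb1 : β w = 1 := by have := hβle w; omega
      have e : ∀ x ∈ range 8, od w x = 1 - α x := by
        intro x _; simp only [hod, hb1]; have := hαle x; omega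
      rw [sum_congr rfl e]
      have h2 : ∑ x ∈ range 8, (1 - α x) + ∑ x ∈ range 8, α x = 8 := by
        rw [← sum_add_distrib]
        rw [sum_congr rfl fun x _ => (by have := hαle x; omega : 1 - α x + α x = 1)]; simp
      omega
  have kcol : ∀ x, ∑ w ∈ range 8, od w x = if α x = 0 then B else 8 - B := by
    intro x
    by_cases ha : α x = 0
    · rw [if_pos ha]
      refine sum_congr rfl fun w _ => ?_
      simp only [hod, ha, add_zero]
      have := hβle w; omega
    · rw [if_neg ha]
      have ha1 : α x = 1 := by have := hαle x; omega
      have e : ∀ w ∈ range 8, od w x = 1 - β w := by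
        intro w _; simp only [hod, ha1]; have := hβle w; omega
      rw [sum_congr rfl e]
      have h2 : ∑ w ∈ range 8, (1 - β w) + ∑ w ∈ range 8, β w = 8 := by
        rw [← sum_add_distrib]
        rw [sum_congr rfl fun w _ => (by have := hβle w; omega : 1 - β w + β w = 1)]; simp
      omega
  -- number of rows with β = 1 is B, with β = 0 is 8 - B (as sums of indicators)
  have hrowsB : ∑ w ∈ range 8, (if β w = 0 then (0:ℕ) else 1) = B := by
    rw [hB]; exact sum_congr rfl fun w _ => by have := hβle w; split_ifs <;> omega
  have hrowsB' : ∑ w ∈ range 8, (if β w = 0 then (1:ℕ) else 0) = 8 - B := by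
    have : ∑ w ∈ range 8, (if β w = 0 then (1:ℕ) else 0) + ∑ w ∈ range 8, (if β w = 0 then (0:ℕ) else 1) = 8 := by
      rw [← sum_add_distrib, sum_congr rfl fun w _ => (by split_ifs <;> rfl : (if β w = 0 then (1:ℕ) else 0) + (if β w = 0 then 0 else 1) = 1)]
      simp
    omega
  have hcolsA : ∑ x ∈ range 8, (if α x = 0 then (0:ℕ) else 1) = A := by
    rw [hA]; exact sum_congr rfl fun x _ => by have := hαle x; split_ifs <;> omega
  have hcolsA' : ∑ x ∈ range 8, (if α x = 0 then (1:ℕ) else 0) = 8 - A := by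
    have : ∑ x ∈ range 8, (if α x = 0 then (1:ℕ) else 0) + ∑ x ∈ range 8, (if α x = 0 then (0:ℕ) else 1) = 8 := by
      rw [← sum_add_distrib, sum_congr rfl fun x _ => (by split_ifs <;> rfl : (if α x = 0 then (1:ℕ) else 0) + (if α x = 0 then 0 else 1) = 1)]
      simp
    omega
  have EO : O = (8 - B) * A + B * (8 - A) := by
    rw [hO, sum_congr rfl fun w _ => krow w]
    have e : ∀ w ∈ range 8, (if β w = 0 then A else 8 - A) = (if β w = 0 then (1:ℕ) else 0) * A + (if β w = 0 then (0:ℕ) else 1) * (8 - A) := by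
      intro w _; split_ifs <;> simp
    rw [sum_congr rfl e, sum_add_distrib, ← sum_mul, ← sum_mul, hrowsB, hrowsB']
  -- per-row and per-column capacity for threes
  have capRow : ∀ w < 8, (∑ x ∈ range 8, od w x) + 2 * ∑ x ∈ range 8, th w x ≤ 6 := by
    intro w hw
    rw [← hrow w hw, mul_sum, ← sum_add_distrib]
    exact sum_le_sum fun x hx => P2 w x hw (mem_range.1 hx)
  have capCol : ∀ x < 8, (∑ w ∈ range 8, od w x) + 2 * ∑ w ∈ range 8, th w x ≤ 6 := by
    intro x hx
    rw [← hcol x hx, mul_sum, ← sum_add_distrib]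
    exact sum_le_sum fun w hw => P2 w x (mem_range.1 hw) hx
  -- feasibility of A, B
  have feasA : (B < 8 → A ≤ 6) ∧ (0 < B → 2 ≤ A) := by
    constructor
    · intro hB
      -- some row has β = 0
      by_contra hA6
      have hall : ∀ w ∈ range 8, (if β w = 0 then (1:ℕ) else 0) = 0 := by
        intro w hw
        by_cases hb : β w = 0
        · exfalso
          have := capRow w (mem_range.1 hw); rw [krow w, if_pos hb] at this; omega
        · rw [if_neg hb]
      have := hrowsB'; rw [sum_congr rfl hall] at this; simp at this; omega
    · intro hB
      by_contra hA2
      have hall : ∀ w ∈ range 8, (if β w = 0 then (0:ℕ) else 1) = 0 := by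
        intro w hw
        by_cases hb : β w = 0
        · rw [if_pos hb]
        · exfalso
          have := capRow w (mem_range.1 hw); rw [krow w, if_neg hb] at this; omega
      have := hrowsB; rw [sum_congr rfl hall] at this; simp at this; omega
  have feasB : (A < 8 → B ≤ 6) ∧ (0 < A → 2 ≤ B) := by
    constructor
    · intro hA'
      by_contra hB6
      have hall : ∀ x ∈ range 8, (if α x = 0 then (1:ℕ) else 0) = 0 := by
        intro x hx
        by_cases ha : α x = 0
        · exfalso
          have := capCol x (mem_range.1 hx); rw [kcol x, if_pos ha] at this; omega
        · rw [if_neg ha]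
      have := hcolsA'; rw [sum_congr rfl hall] at this; simp at this; omega
    · intro hA'
      by_contra hB2
      have hall : ∀ x ∈ range 8, (if α x = 0 then (0:ℕ) else 1) = 0 := by
        intro x hx
        by_cases ha : α x = 0
        · rw [if_pos ha]
        · exfalso
          have := capCol x (mem_range.1 hx); rw [kcol x, if_neg ha] at this; omega
      have := hcolsA; rw [sum_congr rfl hall] at this; simp at this; omega
  -- the two blocks of threes
  set TA := ∑ w ∈ range 8, ∑ x ∈ range 8, (if β w = 0 then th w x else 0) with hTA
  set TB := ∑ w ∈ range 8, ∑ x ∈ range 8, (if β w = 0 then 0 else th w x) with hTB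
  have ETT : T = TA + TB := by
    rw [hT, hTA, hTB, ← sum_add_distrib]
    refine sum_congr rfl fun w _ => ?_
    rw [← sum_add_distrib]
    exact sum_congr rfl fun x _ => by split_ifs <;> simp
  -- threes in a β=0 row sit in α=1 columns, threes in a β=1 row sit in α=0 columns
  have blockA : ∀ w x, w < 8 → x < 8 → β w = 0 → th w x = (if α x = 0 then 0 else th w x) := by
    intro w x hw hx hb
    by_cases ha : α x = 0
    · rw [if_pos ha]
      by_contra hne
      have h1 : th w x = 1 := by have := thle w x; omega
      have := P3 w x hw hx h1
      simp only [hod, hb, ha] at this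
      exact absurd this (by norm_num)
    · rw [if_neg ha]
  have blockB : ∀ w x, w < 8 → x < 8 → β w ≠ 0 → th w x = (if α x = 0 then th w x else 0) := by
    intro w x hw hx hb
    by_cases ha : α x = 0
    · rw [if_pos ha]
    · rw [if_neg ha]
      by_contra hne
      have h1 : th w x = 1 := by have := thle w x; omega
      have := P3 w x hw hx h1
      have hb1 : β w = 1 := by have := hβle w; omega
      have ha1 : α x = 1 := by have := hαle x; omega
      simp only [hod, hb1, ha1] at this
      exact absurd this (by norm_num)
  -- (i) rows with β = 0: 2·(threes) ≤ 6 − A each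
  have bound1 : 2 * TA ≤ (8 - B) * (6 - A) := by
    have hrowle : ∀ w ∈ range 8, 2 * ∑ x ∈ range 8, (if β w = 0 then th w x else 0) ≤ (if β w = 0 then (1:ℕ) else 0) * (6 - A) := by
      intro w hw
      by_cases hb : β w = 0
      · simp only [if_pos hb, one_mul]
        have := capRow w (mem_range.1 hw); rw [krow w, if_pos hb] at this; omega
      · simp only [if_neg hb, zero_mul]; simp
    have := sum_le_sum hrowle
    rw [← mul_sum, ← sum_mul, hrowsB'] at this
    exact this
  -- (ii) columns with α = 1 bound the same threes: 2·TA ≤ A·(B − 2)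
  have bound2 : 2 * TA ≤ A * (B - 2) := by
    have eTA : TA = ∑ x ∈ range 8, ∑ w ∈ range 8, (if β w = 0 then th w x else 0) := by rw [hTA, sum_comm]
    have hcolle : ∀ x ∈ range 8, 2 * ∑ w ∈ range 8, (if β w = 0 then th w x else 0) ≤ (if α x = 0 then (0:ℕ) else 1) * (B - 2) := by
      intro x hx
      by_cases ha : α x = 0
      · rw [if_pos ha, zero_mul]
        have hz : ∀ w ∈ range 8, (if β w = 0 then th w x else 0) = 0 := by
          intro w hw
          by_cases hb : β w = 0
          · rw [if_pos hb, blockA w x (mem_range.1 hw) (mem_range.1 hx) hb, if_pos ha]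
          · rw [if_neg hb]
        rw [sum_congr rfl hz]; simp
      · rw [if_neg ha, one_mul]
        have hle : ∑ w ∈ range 8, (if β w = 0 then th w x else 0) ≤ ∑ w ∈ range 8, th w x :=
          sum_le_sum fun w _ => by split_ifs <;> omega
        have := capCol x (mem_range.1 hx); rw [kcol x, if_neg ha] at this; omega
    have := sum_le_sum hcolle
    rw [← mul_sum, ← sum_mul, hcolsA, ← eTA] at this
    exact this
  -- (iii) rows with β = 1: 2·TB ≤ B·(A − 2)
  have bound3 : 2 * TB ≤ B * (A - 2) := by
    have hrowle : ∀ w ∈ range 8, 2 * ∑ x ∈ range 8, (if β w = 0 then 0 else th w x) ≤ (if β w = 0 then (0:ℕ) else 1) * (A - 2) := by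
      intro w hw
      by_cases hb : β w = 0
      · simp only [if_pos hb, zero_mul]; simp
      · simp only [if_neg hb, one_mul]
        have := capRow w (mem_range.1 hw); rw [krow w, if_neg hb] at this; omega
    have := sum_le_sum hrowle
    rw [← mul_sum, ← sum_mul, hrowsB] at this
    exact this
  -- (iv) columns with α = 0: 2·TB ≤ (8 − A)(6 − B)
  have bound4 : 2 * TB ≤ (8 - A) * (6 - B) := by
    have eTB : TB = ∑ x ∈ range 8, ∑ w ∈ range 8, (if β w = 0 then 0 else th w x) := by rw [hTB, sum_comm]
    have hcolle : ∀ x ∈ range 8, 2 * ∑ w ∈ range 8, (if β w = 0 then 0 else th w x) ≤ (if α x = 0 then (1:ℕ) else 0) * (6 - B) := by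
      intro x hx
      by_cases ha : α x = 0
      · rw [if_pos ha, one_mul]
        have hle : ∑ w ∈ range 8, (if β w = 0 then 0 else th w x) ≤ ∑ w ∈ range 8, th w x :=
          sum_le_sum fun w _ => by split_ifs <;> omega
        have := capCol x (mem_range.1 hx); rw [kcol x, if_pos ha] at this; omega
      · rw [if_neg ha, zero_mul]
        have hz : ∀ w ∈ range 8, (if β w = 0 then 0 else th w x) = 0 := by
          intro w hw
          by_cases hb : β w = 0
          · rw [if_pos hb]
          · rw [if_neg hb, blockB w x (mem_range.1 hw) (mem_range.1 hx) hb, if_neg ha]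
        rw [sum_congr rfl hz]; simp
    have := sum_le_sum hcolle
    rw [← mul_sum, ← sum_mul, hcolsA', ← eTB] at this
    exact this
  -- arithmetic
  have core := arith_core7 ⟨A, by omega⟩ ⟨B, by omega⟩ ⟨feasA.1, feasA.2, feasB.1, feasB.2⟩
  simp only at core
  have hminA : 4 * TA ≤ 2 * min ((8 - B) * (6 - A)) (A * (B - 2)) := by
    rcases le_total ((8 - B) * (6 - A)) (A * (B - 2)) with h | h
    · rw [min_eq_left h]; omega
    · rw [min_eq_right h]; omega
  have hminB : 4 * TB ≤ 2 * min (B * (A - 2)) ((8 - A) * (6 - B)) := by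
    rcases le_total (B * (A - 2)) ((8 - A) * (6 - B)) with h | h
    · rw [min_eq_left h]; omega
    · rw [min_eq_right h]; omega
  have h4T : 4 * T ≤ O := by rw [ETT, EO]; omega
  omega

end Summit.MatrixMultiplication.OmegaCensus.SmallFormats
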